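import Literature.AlgebraicGeometry.Surfaces.K3LatticeOrthogonalNegTwoVectorOrbits
import Literature.Topology.FourManifolds.LatticeFormsNegTwoVectorOrbitsOriented
import HarnessLib

/-!
# The walls `Δ_h` of the degree-`2d` K3 period domain under the groups of the moduli problem, `Õ⁺(Λ_d)` and `O⁺(Λ_d)`
# (Gritsenko–Hulek–Sankaran, Handbook of Moduli I §2.5 with Doc. Math. 13 (2008) Prop. 2.4 (ii), (iv))

Family `hodge`, layer `Literature/AlgebraicGeometry/Surfaces`. Sequel of `K3LatticeOrthogonalNegTwoVectorOrbits.lean` (row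
g41-#3: the `O(Λ_d)`- and `Õ(Λ_d)`-orbits of `(−2)`- and `(−2d)`-vectors of `Λ_d = ℓ^⊥ ⊂ Λ_{K3}`, transported from the model
`L_{2d} = (E₈(−1)^{⊕2} ⊕ U^{⊕2}) ⊕ ℤ(−2d)`), of `Topology/FourManifolds/LatticeFormsNegTwoVectorOrbitsOriented.lean` (row g46-#9:
GHS 2008 Prop. 2.4 with its printed groups `Õ⁺`, `O⁺` in the model) and of §7 of
`Topology/FourManifolds/LatticeFormsOrientationCharacter.lean` (row g46-#8: the orientation character travels along an
isometry `e : L ⥲ L'`). Written for lane `lit-hodgefound` (Track 2 foundations; prover seat `lit-hodgefound-p18`, gen 46,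
row g46-#10). THEOREMS ONLY — no definition, no named fact, no instance, no notation.

The modular group of polarised K3 surfaces of degree `2d` is `Õ⁺(L_{2d})` (GHS 2013 Thm. 2.9: `ℱ_{2d} = Õ⁺(L_{2d})\Ω_{L_{2d}}`),
not `Õ(L_{2d})`; the predecessor counted the orbits of `Δ_h` under `Õ(Λ_d)` and `O(Λ_d)` because the tree had no `O⁺`.
Here the counts are given for `Õ⁺(Λ_d)` and `O⁺(Λ_d)` (same numbers: a `(−2)`-vector of `L_{2d} ⊇ 2U` has an orthogonal
`(+2)`-vector `u`, and `σ_u ∈ Õ ∖ O⁺`).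

## Sources, verbatim

GHS, Handbook of Moduli I (held text `paper:arxiv-1012.4155` p. 8), §2.5: "`ℱ_{2d} = Õ⁺(L_{2d}) \ Ω_{L_{2d}}` […] For
`h ∈ L_{K3}` […] `Δ_h = {δ ∈ L_{K3} | δ² = −2, (δ, h) = 0}` […] There are only finitely many `Õ(L_{2d})`-orbits in `Δ_h`
[…] in fact there are at most two orbits by [GHSprop]." [GHSprop] = Doc. Math. 13 (2008) Prop. 2.4 (held text
`paper:arxiv-math_0609774` pp. 5–6): "(ii) There is one `Õ⁺(L_{2d}^{(m)})`-orbit of `(−2)`-vectors `r` in `L_{2d}^{(m)}` with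
`div(r) = 1`. If `d ≡ 1 mod 4` then there is a second orbit of `(−2)`-vectors, with `div(r) = 2`. […] (iv) […] The number
of `Õ(L_{2d}^{(m)})`-orbits of `(−2d)`-vectors with `div(r) = 2d` is `2^{ρ(d)}`. The number […] with `div(r) = d` is
`2^{ρ(d)}` if `d` is odd or `d ≡ 4 mod 8`; `2^{ρ(d)+1}` if `d ≡ 0 mod 8`; `2^{ρ(d)−1}` if `d ≡ 2 mod 4`. *Proof.* […] the
`Õ⁺(L)`-orbit of a primitive vector `l ∈ L` is completely defined by two invariants".

## Contents (all proved)

* §1 (namespace `Literature.Topology.FourManifolds`) transport of `O⁺`- and `Õ⁺`-orbit quotients along an isometry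
  `e : Λ ⥲ Λ'` (`natCard_quot_isometryEquiv_isOrientationPreserving_eq_of_isometryEquiv`,
  `natCard_quot_stable_isometryEquiv_isOrientationPreserving_eq_of_isometryEquiv`), on top of
  `IsometryEquiv.exists_isOrientationPreserving_apply_eq_iff_of_isometryEquiv` (row g46-#8).
* §2 (namespace `Literature.AlgebraicGeometry.Surfaces`) for `Λ_{K3}`, `ℓ` primitive with `(ℓ)² = 2d > 0`, `Λ_d = ℓ^⊥`:
  **`k3Lattice_natCard_quot_isometryEquiv_isOrientationPreserving_orthogonal_apply_self_eq_neg_two`** (`O⁺(Λ_d)`-orbits of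
  `Δ_ℓ`: `2` if `d ≡ 1 (mod 4)`, else `1`), **`k3Lattice_natCard_quot_stable_isometryEquiv_isOrientationPreserving_orthogonal_apply_self_eq_neg_two`**
  (the same for `Õ⁺(Λ_d)`, the modular group), and Prop. 2.4 (iv) for `Õ⁺(Λ_d)`:
  `k3Lattice_natCard_quot_stable_isometryEquiv_isOrientationPreserving_orthogonal_neg_twoMul_of_divisor_twoMul` (`2^{ρ(d)}`),
  `…_of_divisor` (`#{x mod d : x² = 1}`).

## References

* [GritsenkoHulekSankaran2013ModuliK3] V. Gritsenko, K. Hulek, G. K. Sankaran, Moduli of K3 surfaces and irreducible symplectic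
  manifolds, Handbook of Moduli I (2013) 459–526 (arXiv:1012.4155): §2.5, Thm. 2.9 and the paragraph before it.
* [GritsenkoHulekSankaran2008Proportionality] V. Gritsenko, K. Hulek, G. K. Sankaran, Hirzebruch–Mumford proportionality and
  locally symmetric varieties of orthogonal type, Doc. Math. 13 (2008) 1–19: Prop. 2.4 (ii), (iv).
* [Huybrechts2016K3] D. Huybrechts, Lectures on K3 Surfaces, Ch. 14 Example 1.11 (i) (`Λ_d ≅ E₈(−1)^{⊕2} ⊕ U^{⊕2} ⊕ ℤ(−2d)`),
  Ch. 6 Prop. 1.5 and Ch. 7 §5.4 (`O⁺`).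
-/

noncomputable section

open Module Function
open LinearMap (BilinForm)
open LinearMap.BilinForm

/-! ### §1 `O⁺`- and `Õ⁺`-orbit quotients are transported along isometries -/

namespace Literature.Topology.FourManifolds

universe u

section Transport

variable {V : Type u} [AddCommGroup V] [Module.Finite ℤ V] [Module.Free ℤ V] {Q : BilinForm ℤ V}
variable {V' : Type u} [AddCommGroup V'] [Module.Finite ℤ V'] [Module.Free ℤ V'] {Q' : BilinForm ℤ V'}

omit [Module.Finite ℤ V] [Module.Free ℤ V] [Module.Finite ℤ V'] [Module.Free ℤ V'] in
/-- `e⁻¹ g' e ∈ Õ(Λ) ⟺ g' ∈ Õ(Λ')` for an isometry `e : Λ ⥲ Λ'`. [cite: GritsenkoHulekSankaran2013ModuliK3, §2.5 proof of Thm. 2.9] [cite: Ebeling1994, §3.3 (functoriality of `u ↦ ū`)] -/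
theorem discriminantGroupCongr_trans_trans_symm_eq_refl_iff (e : Q.IsometryEquiv Q') (g' : Q'.IsometryEquiv Q') :
    (e.trans (g'.trans e.symm)).discriminantGroupCongr = LinearEquiv.refl ℤ _ ↔
      g'.discriminantGroupCongr = LinearEquiv.refl ℤ _ := by
  refine ⟨fun h ↦ ?_, discriminantGroupCongr_trans_trans_symm_eq_refl e⟩
  have h1 := discriminantGroupCongr_symm_trans_trans_eq_refl e h
  have h2 : e.symm.trans ((e.trans (g'.trans e.symm)).trans e) = g' := DFunLike.ext _ _ fun x ↦ by
    change e (e.symm (g' (e (e.symm x)))) = g' x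
    rw [show e (e.symm x) = x from (e : V ≃ₗ[ℤ] V').apply_symm_apply x]
    exact (e : V ≃ₗ[ℤ] V').apply_symm_apply _
  rwa [h2] at h1

/-- **`O⁺`-orbit quotients are transported along isometries**: for `e : Λ ⥲ Λ'` and predicates with `P r ⟺ P' (e r)`,
`{P}/O⁺(Λ)` and `{P'}/O⁺(Λ')` have the same cardinality (`r ↦ e r`, `g ↦ e g e⁻¹` preserves the orientation character).
[cite: Huybrechts2016K3, Ch. 6 Prop. 1.5 (proof) and Ch. 7 §5.4] [cite: GritsenkoHulekSankaran2013ModuliK3, §2.5] -/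
theorem natCard_quot_isometryEquiv_isOrientationPreserving_eq_of_isometryEquiv (e : Q.IsometryEquiv Q') (P : V → Prop)
    (P' : V' → Prop) (hP : ∀ r, P r ↔ P' (e r)) :
    Nat.card (Quot fun r s : {r : V // P r} ↦ ∃ g : Q.IsometryEquiv Q, g.IsOrientationPreserving ∧ g r.1 = s.1) =
      Nat.card (Quot fun r s : {r : V' // P' r} ↦
        ∃ g : Q'.IsometryEquiv Q', g.IsOrientationPreserving ∧ g r.1 = s.1) := by
  refine Nat.card_congr (Quot.congr ((e : V ≃ₗ[ℤ] V').toEquiv.subtypeEquiv hP) ?_)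
  rintro ⟨r, hr⟩ ⟨s, hs⟩
  change (∃ g : Q.IsometryEquiv Q, g.IsOrientationPreserving ∧ g r = s) ↔
    ∃ g' : Q'.IsometryEquiv Q', g'.IsOrientationPreserving ∧ g' (e r) = e s
  have h1 := IsometryEquiv.exists_isOrientationPreserving_apply_eq_iff_of_isometryEquiv e (fun _ ↦ True) r s
  simpa only [true_and] using h1

/-- **`Õ⁺`-orbit quotients are transported along isometries** (`Õ⁺ = {g ∈ O⁺ : ḡ = id}`, the modular group of the period
domains; the conjugate of `g ∈ Õ⁺(Λ)` lies in `Õ⁺(Λ')`). [cite: GritsenkoHulekSankaran2013ModuliK3, §2.5 (Thm. 2.9: `ℱ_{2d} = Õ⁺(L_{2d})\Ω`)] [cite: Huybrechts2016K3, Ch. 7 §5.4] -/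
theorem natCard_quot_stable_isometryEquiv_isOrientationPreserving_eq_of_isometryEquiv (e : Q.IsometryEquiv Q')
    (P : V → Prop) (P' : V' → Prop) (hP : ∀ r, P r ↔ P' (e r)) :
    Nat.card (Quot fun r s : {r : V // P r} ↦ ∃ g : Q.IsometryEquiv Q,
        g.discriminantGroupCongr = LinearEquiv.refl ℤ _ ∧ g.IsOrientationPreserving ∧ g r.1 = s.1) =
      Nat.card (Quot fun r s : {r : V' // P' r} ↦ ∃ g : Q'.IsometryEquiv Q',
        g.discriminantGroupCongr = LinearEquiv.refl ℤ _ ∧ g.IsOrientationPreserving ∧ g r.1 = s.1) := by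
  refine Nat.card_congr (Quot.congr ((e : V ≃ₗ[ℤ] V').toEquiv.subtypeEquiv hP) ?_)
  rintro ⟨r, hr⟩ ⟨s, hs⟩
  change (∃ g : Q.IsometryEquiv Q, g.discriminantGroupCongr = LinearEquiv.refl ℤ _ ∧ g.IsOrientationPreserving ∧ g r = s) ↔
    ∃ g' : Q'.IsometryEquiv Q',
      g'.discriminantGroupCongr = LinearEquiv.refl ℤ _ ∧ g'.IsOrientationPreserving ∧ g' (e r) = e s
  rw [IsometryEquiv.exists_isOrientationPreserving_apply_eq_iff_of_isometryEquiv e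
    (fun g ↦ g.discriminantGroupCongr = LinearEquiv.refl ℤ _) r s]
  simp only [discriminantGroupCongr_trans_trans_symm_eq_refl_iff]

end Transport

end Literature.Topology.FourManifolds

/-! ### §2 The K3 lattice: `Δ_ℓ ⊂ Λ_d = ℓ^⊥` under `O⁺(Λ_d)` and `Õ⁺(Λ_d)`, and the `(−2d)`-vectors under `Õ⁺(Λ_d)` -/

namespace Literature.AlgebraicGeometry.Surfaces

open Literature.Topology.FourManifolds

variable {ℓ : K3Index → ℤ} {d : ℕ}

/-- A vector of square `2d > 0` is nonzero. [cite: Huybrechts2016K3, Ch. 14 Example 1.11 (i)] -/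
private theorem ne_zero_of_sq_eq_two_mul' (hd : 0 < d) (hℓ : Matrix.toBilin' k3Gram ℓ ℓ = 2 * d) : ℓ ≠ 0 := by
  rintro rfl
  simp only [map_zero] at hℓ
  omega

/-- **The walls `Δ_h` form one or two orbits under `O⁺(Λ_d)`**: for `Λ_{K3}`, a primitive `ℓ` with `(ℓ)² = 2d > 0` and
`Λ_d = ℓ^⊥`, the `(−2)`-vectors of `Λ_d` form exactly two `O⁺(Λ_d)`-orbits if `d ≡ 1 (mod 4)` and one otherwise.
[cite: GritsenkoHulekSankaran2013ModuliK3, §2.5 before Thm. 2.9] [cite: GritsenkoHulekSankaran2008Proportionality, Prop. 2.4 (ii)] [cite: Huybrechts2016K3, Ch. 14 Example 1.11 (i)] -/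
theorem k3Lattice_natCard_quot_isometryEquiv_isOrientationPreserving_orthogonal_apply_self_eq_neg_two (hd : 0 < d)
    (hℓ : Matrix.toBilin' k3Gram ℓ ℓ = 2 * d)
    (hℓsat : ∀ (k : ℤ) (w : K3Index → ℤ), k ≠ 0 → k • w ∈ ℤ ∙ ℓ → w ∈ ℤ ∙ ℓ) :
    Nat.card (Quot fun r s : {r : (Matrix.toBilin' k3Gram).orthogonal (ℤ ∙ ℓ) //
        ((Matrix.toBilin' k3Gram).restrict ((Matrix.toBilin' k3Gram).orthogonal (ℤ ∙ ℓ))) r r = -2} ↦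
      ∃ g : ((Matrix.toBilin' k3Gram).restrict ((Matrix.toBilin' k3Gram).orthogonal (ℤ ∙ ℓ))).IsometryEquiv
          ((Matrix.toBilin' k3Gram).restrict ((Matrix.toBilin' k3Gram).orthogonal (ℤ ∙ ℓ))),
        g.IsOrientationPreserving ∧ g r.1 = s.1) =
      if d % 4 = 1 then 2 else 1 := by
  obtain ⟨e⟩ := k3Lattice_restrict_orthogonal_equivalent (d := (d : ℤ)) hℓ (ne_zero_of_sq_eq_two_mul' hd hℓ) hℓsat
  rw [natCard_quot_isometryEquiv_isOrientationPreserving_eq_of_isometryEquiv e _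
    (fun r ↦ (((LinearMap.BilinForm.pi fun _ : Fin 2 ↦ -e8Form).prod (hyperbolicSum 2)).prod
      ((-(2 * d : ℤ)) • LinearMap.mul ℤ ℤ)) r r = -2) (fun r ↦ by rw [e.map_app])]
  exact natCard_quot_isometryEquiv_isOrientationPreserving_latticeL2dm_apply_self_eq_neg_two 2 d hd

/-- **… and under the modular group `Õ⁺(Λ_d)`** (`ℱ_{2d} = Õ⁺(L_{2d})\Ω_{L_{2d}}`): two `Õ⁺(Λ_d)`-orbits of `(−2)`-vectors in
`Λ_d` if `d ≡ 1 (mod 4)`, one otherwise — "in fact there are at most two orbits by [GHSprop]", [GHSprop] = Prop. 2.4 (ii)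
with its printed group `Õ⁺(L_{2d})`. [cite: GritsenkoHulekSankaran2013ModuliK3, §2.5 Thm. 2.9 and before] [cite: GritsenkoHulekSankaran2008Proportionality, Prop. 2.4 (ii)] [cite: Huybrechts2016K3, Ch. 14 Example 1.11 (i)] -/
theorem k3Lattice_natCard_quot_stable_isometryEquiv_isOrientationPreserving_orthogonal_apply_self_eq_neg_two (hd : 0 < d)
    (hℓ : Matrix.toBilin' k3Gram ℓ ℓ = 2 * d)
    (hℓsat : ∀ (k : ℤ) (w : K3Index → ℤ), k ≠ 0 → k • w ∈ ℤ ∙ ℓ → w ∈ ℤ ∙ ℓ) :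
    Nat.card (Quot fun r s : {r : (Matrix.toBilin' k3Gram).orthogonal (ℤ ∙ ℓ) //
        ((Matrix.toBilin' k3Gram).restrict ((Matrix.toBilin' k3Gram).orthogonal (ℤ ∙ ℓ))) r r = -2} ↦
      ∃ g : ((Matrix.toBilin' k3Gram).restrict ((Matrix.toBilin' k3Gram).orthogonal (ℤ ∙ ℓ))).IsometryEquiv
          ((Matrix.toBilin' k3Gram).restrict ((Matrix.toBilin' k3Gram).orthogonal (ℤ ∙ ℓ))),
        g.discriminantGroupCongr = LinearEquiv.refl ℤ _ ∧ g.IsOrientationPreserving ∧ g r.1 = s.1) =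
      if d % 4 = 1 then 2 else 1 := by
  obtain ⟨e⟩ := k3Lattice_restrict_orthogonal_equivalent (d := (d : ℤ)) hℓ (ne_zero_of_sq_eq_two_mul' hd hℓ) hℓsat
  rw [natCard_quot_stable_isometryEquiv_isOrientationPreserving_eq_of_isometryEquiv e _
    (fun r ↦ (((LinearMap.BilinForm.pi fun _ : Fin 2 ↦ -e8Form).prod (hyperbolicSum 2)).prod
      ((-(2 * d : ℤ)) • LinearMap.mul ℤ ℤ)) r r = -2) (fun r ↦ by rw [e.map_app])]
  exact natCard_quot_stable_isometryEquiv_isOrientationPreserving_latticeL2dm_apply_self_eq_neg_two 2 d hd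

/-- **GHS Prop. 2.4 (iv) for `Λ_d ⊂ Λ_{K3}` under `Õ⁺(Λ_d)`, `div(r) = 2d`**: the `Õ⁺(Λ_d)`-orbits of `(−2d)`-vectors
`r ∈ Λ_d` with `(r, Λ_d) = 2dℤ` number `2^{ρ(d)}`. [cite: GritsenkoHulekSankaran2008Proportionality, Prop. 2.4 (iv)] [cite: Huybrechts2016K3, Ch. 14 Example 1.11 (i)] -/
theorem k3Lattice_natCard_quot_stable_isometryEquiv_isOrientationPreserving_orthogonal_neg_twoMul_of_divisor_twoMul
    (hd : 0 < d) (hℓ : Matrix.toBilin' k3Gram ℓ ℓ = 2 * d)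
    (hℓsat : ∀ (k : ℤ) (w : K3Index → ℤ), k ≠ 0 → k • w ∈ ℤ ∙ ℓ → w ∈ ℤ ∙ ℓ) :
    Nat.card (Quot fun r s : {r : (Matrix.toBilin' k3Gram).orthogonal (ℤ ∙ ℓ) //
        ((Matrix.toBilin' k3Gram).restrict ((Matrix.toBilin' k3Gram).orthogonal (ℤ ∙ ℓ))) r r = -(2 * d : ℤ) ∧
        (∀ z, (2 * d : ℤ) ∣ ((Matrix.toBilin' k3Gram).restrict ((Matrix.toBilin' k3Gram).orthogonal (ℤ ∙ ℓ))) r z) ∧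
        ∃ r', ((Matrix.toBilin' k3Gram).restrict ((Matrix.toBilin' k3Gram).orthogonal (ℤ ∙ ℓ))) r r' = 2 * d} ↦
      ∃ g : ((Matrix.toBilin' k3Gram).restrict ((Matrix.toBilin' k3Gram).orthogonal (ℤ ∙ ℓ))).IsometryEquiv
          ((Matrix.toBilin' k3Gram).restrict ((Matrix.toBilin' k3Gram).orthogonal (ℤ ∙ ℓ))),
        g.discriminantGroupCongr = LinearEquiv.refl ℤ _ ∧ g.IsOrientationPreserving ∧ g r.1 = s.1) =
      2 ^ d.primeFactors.card := by
  obtain ⟨e⟩ := k3Lattice_restrict_orthogonal_equivalent (d := (d : ℤ)) hℓ (ne_zero_of_sq_eq_two_mul' hd hℓ) hℓsat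
  rw [natCard_quot_stable_isometryEquiv_isOrientationPreserving_eq_of_isometryEquiv e _
    (fun r ↦ (((LinearMap.BilinForm.pi fun _ : Fin 2 ↦ -e8Form).prod (hyperbolicSum 2)).prod
      ((-(2 * d : ℤ)) • LinearMap.mul ℤ ℤ)) r r = -(2 * d : ℤ) ∧
      (∀ z, (2 * d : ℤ) ∣ (((LinearMap.BilinForm.pi fun _ : Fin 2 ↦ -e8Form).prod (hyperbolicSum 2)).prod
        ((-(2 * d : ℤ)) • LinearMap.mul ℤ ℤ)) r z) ∧
      ∃ r', (((LinearMap.BilinForm.pi fun _ : Fin 2 ↦ -e8Form).prod (hyperbolicSum 2)).prod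
        ((-(2 * d : ℤ)) • LinearMap.mul ℤ ℤ)) r r' = 2 * d)
    (fun r ↦ by rw [e.map_app, forall_dvd_apply_iff_of_isometryEquiv, exists_apply_eq_iff_of_isometryEquiv])]
  exact natCard_quot_stable_isometryEquiv_isOrientationPreserving_latticeL2dm_neg_twoMul_of_divisor_twoMul 2 d hd

/-- **GHS Prop. 2.4 (iv) for `Λ_d ⊂ Λ_{K3}` under `Õ⁺(Λ_d)`, `div(r) = d`**: the `Õ⁺(Λ_d)`-orbits of `(−2d)`-vectors `r ∈ Λ_d`
with `(r, Λ_d) = dℤ` number `#{x mod d : x² ≡ 1 (d)}`. [cite: GritsenkoHulekSankaran2008Proportionality, Prop. 2.4 (iv)] [cite: Huybrechts2016K3, Ch. 14 Example 1.11 (i)] -/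
theorem k3Lattice_natCard_quot_stable_isometryEquiv_isOrientationPreserving_orthogonal_neg_twoMul_of_divisor (hd : 0 < d)
    (hℓ : Matrix.toBilin' k3Gram ℓ ℓ = 2 * d)
    (hℓsat : ∀ (k : ℤ) (w : K3Index → ℤ), k ≠ 0 → k • w ∈ ℤ ∙ ℓ → w ∈ ℤ ∙ ℓ) :
    Nat.card (Quot fun r s : {r : (Matrix.toBilin' k3Gram).orthogonal (ℤ ∙ ℓ) //
        ((Matrix.toBilin' k3Gram).restrict ((Matrix.toBilin' k3Gram).orthogonal (ℤ ∙ ℓ))) r r = -(2 * d : ℤ) ∧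
        (∀ z, (d : ℤ) ∣ ((Matrix.toBilin' k3Gram).restrict ((Matrix.toBilin' k3Gram).orthogonal (ℤ ∙ ℓ))) r z) ∧
        ∃ r', ((Matrix.toBilin' k3Gram).restrict ((Matrix.toBilin' k3Gram).orthogonal (ℤ ∙ ℓ))) r r' = d} ↦
      ∃ g : ((Matrix.toBilin' k3Gram).restrict ((Matrix.toBilin' k3Gram).orthogonal (ℤ ∙ ℓ))).IsometryEquiv
          ((Matrix.toBilin' k3Gram).restrict ((Matrix.toBilin' k3Gram).orthogonal (ℤ ∙ ℓ))),
        g.discriminantGroupCongr = LinearEquiv.refl ℤ _ ∧ g.IsOrientationPreserving ∧ g r.1 = s.1) =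
      Nat.card {u : ZMod d // u ^ 2 = 1} := by
  obtain ⟨e⟩ := k3Lattice_restrict_orthogonal_equivalent (d := (d : ℤ)) hℓ (ne_zero_of_sq_eq_two_mul' hd hℓ) hℓsat
  rw [natCard_quot_stable_isometryEquiv_isOrientationPreserving_eq_of_isometryEquiv e _
    (fun r ↦ (((LinearMap.BilinForm.pi fun _ : Fin 2 ↦ -e8Form).prod (hyperbolicSum 2)).prod
      ((-(2 * d : ℤ)) • LinearMap.mul ℤ ℤ)) r r = -(2 * d : ℤ) ∧
      (∀ z, (d : ℤ) ∣ (((LinearMap.BilinForm.pi fun _ : Fin 2 ↦ -e8Form).prod (hyperbolicSum 2)).prod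
        ((-(2 * d : ℤ)) • LinearMap.mul ℤ ℤ)) r z) ∧
      ∃ r', (((LinearMap.BilinForm.pi fun _ : Fin 2 ↦ -e8Form).prod (hyperbolicSum 2)).prod
        ((-(2 * d : ℤ)) • LinearMap.mul ℤ ℤ)) r r' = d)
    (fun r ↦ by rw [e.map_app, forall_dvd_apply_iff_of_isometryEquiv, exists_apply_eq_iff_of_isometryEquiv])]
  exact natCard_quot_stable_isometryEquiv_isOrientationPreserving_latticeL2dm_neg_twoMul_of_divisor 2 d hd

end Literature.AlgebraicGeometry.Surfaces

end
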